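import Summits.HubbardSuperconductivity.HubbardSuperconductivity.Theorems.BalabanIRBirComplexStableXYRLiftIdentity
import Summits.HubbardSuperconductivity.HubbardSuperconductivity.Theorems.BalabanIRBirComplexStableXYRStubTreeGaugeDecomposition
import Summits.HubbardSuperconductivity.HubbardSuperconductivity.Theorems.BalabanIRBirComplexStableXYRStubPinnedTiling
import Literature.MathematicalPhysics.QuantumFieldTheory.TorusChartPinnedUnfolding
import HarnessLib

/-!
# Crux `BirComplexStableXYR`, line `fat-gaussian-defect-calculus`: stub U3 `stub_unfoldedLiftIdentity`

Registered stub (lead c7, skeleton `Cruxes/BirComplexStableXYR/Lines/fat_gaussian_defect_calculus.lean`):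
**the unfolded lift identity on a charted torus.**  For a continuous `2πℤ^Λ`-periodic `g` and a smoothed
box `χ_v` (`Σ_n χ_v(s - 2πn) = 1`), the cube integral `∫_{[0,2π)^Λ} g` is the `HasSum`, over the integer
`1`-cochains `a` in TREE GAUGE (vanishing on the axial comb tree `T`), of the integrals over the PINNED field
space `{φ : φ 0 ∈ [0,2π)}` of `g` times the bond weight `W_a(φ) = Π_{x,i} χ_v(d₀φ(x,i) − 2π a(x,i))`.

Proof (everything for an abstract weight `w ≥ 0`, continuous, with `Σ_n w(s - 2πn) = 1`; the smoothed box is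
inserted at the end):
* `hasSum_setIntegral_cube_mul_weight` — `Σ_{all a} ∫_cube g W_a = ∫_cube g` (bond partition of unity and
  dominated exchange, the landed `hasSum_integral_mul_prod`, curried from `Λ × Fin d → ℤ`);
* `treeGauge_bijective` — `(a_T, n) ↦ a_T + d₀ n` is a bijection `TG × {n // n 0 = 0} ≃ (Λ → Fin d → ℤ)`
  (the landed `treeGaugeDecomposition`, stub U1);
* `hasSum_setIntegral_cube_sub` — pinned tiling with `φ - 2πn` (the landed `hasSum_setIntegral_cube_translate`,
  stub U2, reindexed by `n ↦ -n`);
* `integrableOn_pinned_mul_weight` — `g W_a` is integrable on the pinned set: its pinned translates are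
  `g W_{a - d₀ m}` (periodicity of `g`, `d₀` linear), an injective subfamily of the summable family of all cube
  integrals (`TorusChart.integrableOn_pinnedSet_of_summable`);
* `hasSum_treeGauge_pinned` — regroup the all-`a` sum along the bijection and sum each fibre by the pinned
  tiling (`HasSum.prod_fiberwise`), using `W_{a_T + d₀ n}(φ) = W_{a_T}(φ - 2πn)`.
No definitions; sorry-free. [folklore]
-/

set_option linter.dupNamespace false -- summit = problem name (single-conjunct summit), D-0017

namespace Summit.HubbardSuperconductivity.HubbardSuperconductivity.Theorems.FSUnfolding

open MeasureTheory Literature.MathematicalPhysics.QuantumFieldTheory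

section UnfoldedLift

variable {Λ : Type*} [AddCommGroup Λ] {d : ℕ} (F : TorusChart Λ d)

/-- Shifting the integer cochain by a coboundary is translating the field:
`d₀φ(x,i) − 2π(a(x,i) + n(x + e_i) − n(x)) = d₀(φ − 2πn)(x,i) − 2π a(x,i)`. [folklore] -/
theorem d₀_sub_arg (φ : Λ → ℝ) (a : Λ → Fin d → ℤ) (n : Λ → ℤ) (x : Λ) (i : Fin d) :
    F.d₀ φ x i - 2 * Real.pi * ((a x i + (n (x + F.gen i) - n x) : ℤ) : ℝ) =
      F.d₀ (fun y => φ y - 2 * Real.pi * (n y : ℝ)) x i - 2 * Real.pi * (a x i : ℝ) := by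
  simp only [TorusChart.d₀_apply]
  push_cast
  ring

/-- Translating the field by `2πm` shifts the integer cochain by `-d₀ m`:
`d₀(θ + 2πm)(x,i) − 2π a(x,i) = d₀θ(x,i) − 2π (a − d₀ m)(x,i)`. [folklore] -/
theorem d₀_add_arg (θ : Λ → ℝ) (a : Λ → Fin d → ℤ) (m : Λ → ℤ) (x : Λ) (i : Fin d) :
    F.d₀ (fun y => θ y + 2 * Real.pi * (m y : ℝ)) x i - 2 * Real.pi * (a x i : ℝ) =
      F.d₀ θ x i - 2 * Real.pi * ((a - F.d₀ m) x i : ℝ) := by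
  simp only [TorusChart.d₀_apply, Pi.sub_apply]
  push_cast
  ring

/-- **The tree-gauge bijection.**  `(a_T, n) ↦ a_T + d₀ n` is a bijection from (cochains vanishing on the
axial comb tree) × (`0`-cochains with `n 0 = 0`) onto all integer `1`-cochains (existence and uniqueness of
the landed `treeGaugeDecomposition`). [folklore] -/
theorem treeGauge_bijective :
    Function.Bijective (fun p : {a : Λ → Fin d → ℤ // ∀ (y : Λ) (μ : Fin d),
        (∀ ν : Fin d, μ < ν → F.cval ν y = 0) → F.cval μ y + 1 < F.period μ → a y μ = 0} ×
          {n : Λ → ℤ // n 0 = 0} =>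
      (fun x i => p.1.1 x i + (p.2.1 (x + F.gen i) - p.2.1 x) : Λ → Fin d → ℤ)) := by
  refine ⟨?_, ?_⟩
  · rintro ⟨aT, n⟩ ⟨aT', n'⟩ h
    have hfun : ∀ (y : Λ) (μ : Fin d), aT.1 y μ + (n.1 (y + F.gen μ) - n.1 y) =
        aT'.1 y μ + (n'.1 (y + F.gen μ) - n'.1 y) := fun y μ => by
      have := congr_fun (congr_fun h y) μ
      simpa using this
    have hU := treeGaugeDecomposition F (fun x i => aT.1 x i + (n.1 (x + F.gen i) - n.1 x))
    have hn : n.1 = n'.1 :=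
      hU.unique ⟨n.2, fun y μ hy hμ => by simp only [aT.2 y μ hy hμ, zero_add]⟩
        ⟨n'.2, fun y μ hy hμ => by simp only [hfun y μ, aT'.2 y μ hy hμ, zero_add]⟩
    have haT : aT.1 = aT'.1 := by
      funext x i
      have := hfun x i
      rw [hn] at this
      exact add_right_cancel this
    exact Prod.ext (Subtype.ext haT) (Subtype.ext hn)
  · intro a
    obtain ⟨n, ⟨hn0, hn⟩, -⟩ := treeGaugeDecomposition F a
    refine ⟨(⟨fun x i => a x i - (n (x + F.gen i) - n x), fun y μ hy hμ => ?_⟩, ⟨n, hn0⟩), ?_⟩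
    · simp only [hn y μ hy hμ, sub_self]
    · funext x i
      simp only [sub_add_cancel]

variable [Fintype Λ]

/-- **All-cochain lift identity on the cube.**  For a non-negative continuous weight `w` with
`Σ_n w(s − 2πn) = 1` and a continuous `g`, inserting `1 = Π_{x,i} Σ_{a(x,i)} w(d₀φ(x,i) − 2πa(x,i))` and
exchanging sum and integral: `HasSum (a ↦ ∫_{[0,2π)^Λ} g W_a) (∫_{[0,2π)^Λ} g)` over all `a : Λ → Fin d → ℤ`.
[folklore] -/
theorem hasSum_setIntegral_cube_mul_weight (w : ℝ → ℝ) (hw0 : ∀ s, 0 ≤ w s)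
    (hw1 : ∀ s, HasSum (fun n : ℤ => w (s - 2 * Real.pi * (n : ℝ))) 1) (hwc : Continuous w)
    (g : (Λ → ℝ) → ℂ) (hg : Continuous g) :
    HasSum (fun a : Λ → Fin d → ℤ =>
        ∫ φ in Set.pi Set.univ (fun _ : Λ => Set.Ico (0:ℝ) (2 * Real.pi)),
          g φ * ∏ x : Λ, ∏ i : Fin d, ((w (F.d₀ φ x i - 2 * Real.pi * (a x i : ℝ)) : ℝ) : ℂ))
      (∫ φ in Set.pi Set.univ (fun _ : Λ => Set.Ico (0:ℝ) (2 * Real.pi)), g φ) := by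
  have hK : IsCompact (Set.pi Set.univ fun _ : Λ => Set.Icc (0:ℝ) (2 * Real.pi)) :=
    isCompact_univ_pi fun _ => isCompact_Icc
  have hgi : IntegrableOn g (Set.pi Set.univ fun _ : Λ => Set.Ico (0:ℝ) (2 * Real.pi)) :=
    (hg.continuousOn.integrableOn_compact hK).mono_set
      (Set.pi_mono fun _ _ => Set.Ico_subset_Icc_self)
  have h := hasSum_integral_mul_prod
    (volume.restrict (Set.pi Set.univ fun _ : Λ => Set.Ico (0:ℝ) (2 * Real.pi)))
    (fun (b : Λ × Fin d) (n : ℤ) (φ : Λ → ℝ) => w (F.d₀ φ b.1 b.2 - 2 * Real.pi * (n : ℝ)))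
    (fun b n φ => hw0 _) (fun b φ => hw1 _)
    (fun b n => (hwc.comp (((continuous_apply (b.1 + F.gen b.2)).sub
      (continuous_apply b.1)).sub continuous_const)).aestronglyMeasurable) g hgi
  rw [← (Equiv.curry Λ (Fin d) ℤ).hasSum_iff]
  refine h.congr_fun fun m => ?_
  simp only [Function.comp_apply, Equiv.curry_apply, Function.curry_apply, Fintype.prod_prod_type]

/-- **Pinned tiling, subtractive form.**  For `G` integrable on the pinned set `{φ : φ 0 ∈ [0,2π)}`,
`HasSum (n ↦ ∫_{[0,2π)^Λ} G(φ − 2πn) dφ) (∫_{pinned} G)` over the integer fields `n` with `n 0 = 0`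
(the landed `hasSum_setIntegral_cube_translate`, reindexed by `n ↦ -n`). [folklore] -/
theorem hasSum_setIntegral_cube_sub (G : (Λ → ℝ) → ℂ)
    (hG : IntegrableOn G {φ : Λ → ℝ | φ 0 ∈ Set.Ico 0 (2 * Real.pi)}) :
    HasSum (fun n : {n : Λ → ℤ // n 0 = 0} =>
        ∫ φ in Set.pi Set.univ (fun _ : Λ => Set.Ico (0:ℝ) (2 * Real.pi)),
          G (fun x => φ x - 2 * Real.pi * (n.1 x : ℝ)))
      (∫ φ in {φ : Λ → ℝ | φ 0 ∈ Set.Ico 0 (2 * Real.pi)}, G φ) := by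
  have h := hasSum_setIntegral_cube_translate (0 : Λ) G hG
  have hiff : ∀ n : Λ → ℤ, n 0 = 0 ↔ (Equiv.neg (Λ → ℤ)) n 0 = 0 := fun n => by
    rw [Equiv.neg_apply, Pi.neg_apply, neg_eq_zero]
  refine (((Equiv.neg (Λ → ℤ)).subtypeEquiv hiff).hasSum_iff.2 h).congr_fun fun n => ?_
  simp only [Function.comp_apply, Equiv.subtypeEquiv_apply, Equiv.neg_apply, Pi.neg_apply,
    Int.cast_neg, mul_neg, ← sub_eq_add_neg]

/-- **Integrability of `g W_a` on the pinned set.**  For a periodic continuous `g`, the pinned translates of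
`g W_a` are `(g W_a)(θ + 2πm) = g(θ) W_{a − d₀ m}(θ)`, and `m ↦ a − d₀ m` is injective on `{m // m 0 = 0}`, so
the cube integrals of the norms form a subfamily of the summable family `Σ_{a'} ∫_cube ‖g‖ W_{a'} = ∫_cube ‖g‖`;
conclude by `TorusChart.integrableOn_pinnedSet_of_summable`. [folklore] -/
theorem integrableOn_pinned_mul_weight (w : ℝ → ℝ) (hw0 : ∀ s, 0 ≤ w s)
    (hw1 : ∀ s, HasSum (fun n : ℤ => w (s - 2 * Real.pi * (n : ℝ))) 1) (hwc : Continuous w)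
    (g : (Λ → ℝ) → ℂ) (hg : Continuous g)
    (hper : ∀ (φ : Λ → ℝ) (n : Λ → ℤ), g (fun x => φ x + 2 * Real.pi * (n x : ℝ)) = g φ)
    (a : Λ → Fin d → ℤ) :
    IntegrableOn (fun φ : Λ → ℝ => g φ * ∏ x : Λ, ∏ i : Fin d,
        ((w (F.d₀ φ x i - 2 * Real.pi * (a x i : ℝ)) : ℝ) : ℂ))
      {φ : Λ → ℝ | φ 0 ∈ Set.Ico 0 (2 * Real.pi)} := by
  -- every `g W_{a'}` is continuous, hence integrable on the (bounded) cube
  have hcont : ∀ a' : Λ → Fin d → ℤ, Continuous fun φ : Λ → ℝ => g φ * ∏ x : Λ, ∏ i : Fin d,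
      ((w (F.d₀ φ x i - 2 * Real.pi * (a' x i : ℝ)) : ℝ) : ℂ) := fun a' =>
    hg.mul (continuous_finsetProd _ fun x _ => continuous_finsetProd _ fun i _ =>
      Complex.continuous_ofReal.comp (hwc.comp
        (((continuous_apply (x + F.gen i)).sub (continuous_apply x)).sub continuous_const)))
  have hK : IsCompact (Set.pi Set.univ fun _ : Λ => Set.Icc (0:ℝ) (2 * Real.pi)) :=
    isCompact_univ_pi fun _ => isCompact_Icc
  have hsub : TorusChart.cubeIco Λ ⊆ Set.pi Set.univ fun _ : Λ => Set.Icc (0:ℝ) (2 * Real.pi) :=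
    Set.pi_mono fun _ _ => Set.Ico_subset_Icc_self
  have hcube : ∀ a' : Λ → Fin d → ℤ, IntegrableOn (fun φ : Λ → ℝ => g φ * ∏ x : Λ, ∏ i : Fin d,
      ((w (F.d₀ φ x i - 2 * Real.pi * (a' x i : ℝ)) : ℝ) : ℂ)) (TorusChart.cubeIco Λ) := fun a' =>
    ((hcont a').continuousOn.integrableOn_compact hK).mono_set hsub
  -- the pinned translates
  have htr : ∀ (m : Λ → ℤ) (θ : Λ → ℝ),
      g ((TorusChart.latticeOf m : TorusChart.twoPiLattice Λ) +ᵥ θ) * ∏ x : Λ, ∏ i : Fin d,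
        ((w (F.d₀ ((TorusChart.latticeOf m : TorusChart.twoPiLattice Λ) +ᵥ θ) x i
          - 2 * Real.pi * (a x i : ℝ)) : ℝ) : ℂ) =
      g θ * ∏ x : Λ, ∏ i : Fin d,
        ((w (F.d₀ θ x i - 2 * Real.pi * ((a - F.d₀ m) x i : ℝ)) : ℝ) : ℂ) := by
    intro m θ
    have h1 : ((TorusChart.latticeOf m : TorusChart.twoPiLattice Λ) +ᵥ θ) =
        fun x => θ x + 2 * Real.pi * (m x : ℝ) := by
      rw [TorusChart.latticeOf_vadd]
      funext x
      rw [zsmul_eq_mul]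
      ring
    rw [h1, hper θ m]
    simp only [d₀_add_arg]
  refine TorusChart.integrableOn_pinnedSet_of_summable _ (fun m => ?_) ?_
  · exact (hcube (a - F.d₀ m.1)).congr_fun (fun θ _ => (htr m.1 θ).symm) TorusChart.measurableSet_cubeIco
  · -- the cube integrals of `‖g‖ W_{a'}` are summable over all `a'`
    have hA := hasSum_setIntegral_cube_mul_weight F w hw0 hw1 hwc (fun θ => ((‖g θ‖ : ℝ) : ℂ))
      (Complex.continuous_ofReal.comp hg.norm)
    simp_rw [← Complex.ofReal_prod, ← Complex.ofReal_mul, integral_complex_ofReal] at hA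
    have hr := (Complex.hasSum_ofReal.1 hA).summable
    have hinj : Function.Injective fun m : TorusChart.PinnedInt Λ => a - F.d₀ m.1 := by
      intro m m' h
      have h' : F.d₀ m.1 = F.d₀ m'.1 := sub_right_injective h
      apply Subtype.ext
      funext x
      have hx := congrArg (fun θ => F.prim θ x) h'
      simp only [TorusChart.prim_d₀] at hx
      rwa [m.2, m'.2, sub_zero, sub_zero] at hx
    refine (hr.comp_injective hinj).congr fun m => ?_
    obtain ⟨m, hm⟩ := m
    simp only [Function.comp_apply, htr]
    refine integral_congr_ae (Filter.Eventually.of_forall fun θ => ?_)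
    dsimp only
    rw [norm_mul]
    simp only [← Complex.ofReal_prod]
    rw [Complex.norm_of_nonneg (Finset.prod_nonneg fun x _ => Finset.prod_nonneg fun i _ => hw0 _)]

/-- **Unfolded lift identity (abstract weight).**  For a non-negative continuous weight `w` with
`Σ_n w(s − 2πn) = 1` and a continuous `2πℤ^Λ`-periodic `g`:
`HasSum (a_T ↦ ∫_{φ 0 ∈ [0,2π)} g W_{a_T}) (∫_{[0,2π)^Λ} g)` over the cochains `a_T` in tree gauge.  Regroup
the all-cochain identity along the tree-gauge bijection and sum each fibre by the pinned tiling
(`W_{a_T + d₀n}(φ) = W_{a_T}(φ − 2πn)`, `g(φ − 2πn) = g(φ)`). [folklore] -/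
theorem hasSum_treeGauge_pinned (w : ℝ → ℝ) (hw0 : ∀ s, 0 ≤ w s)
    (hw1 : ∀ s, HasSum (fun n : ℤ => w (s - 2 * Real.pi * (n : ℝ))) 1) (hwc : Continuous w)
    (g : (Λ → ℝ) → ℂ) (hg : Continuous g)
    (hper : ∀ (φ : Λ → ℝ) (n : Λ → ℤ), g (fun x => φ x + 2 * Real.pi * (n x : ℝ)) = g φ) :
    HasSum (fun a : {a : Λ → Fin d → ℤ // ∀ (y : Λ) (μ : Fin d), (∀ ν : Fin d, μ < ν → F.cval ν y = 0) →
          F.cval μ y + 1 < F.period μ → a y μ = 0} =>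
        ∫ φ in {φ : Λ → ℝ | φ 0 ∈ Set.Ico 0 (2 * Real.pi)},
          g φ * ∏ x : Λ, ∏ i : Fin d, ((w (F.d₀ φ x i - 2 * Real.pi * (a.1 x i : ℝ)) : ℝ) : ℂ))
      (∫ φ in Set.pi Set.univ (fun _ : Λ => Set.Ico (0:ℝ) (2 * Real.pi)), g φ) := by
  have hA := hasSum_setIntegral_cube_mul_weight F w hw0 hw1 hwc g hg
  have h2 := ((Equiv.ofBijective _ (treeGauge_bijective F)).hasSum_iff).2 hA
  refine h2.prod_fiberwise fun aT => ?_
  have hD := integrableOn_pinned_mul_weight F w hw0 hw1 hwc g hg hper aT.1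
  refine (hasSum_setIntegral_cube_sub _ hD).congr_fun fun n => ?_
  simp only [Function.comp_apply, Equiv.ofBijective_apply]
  refine integral_congr_ae (Filter.Eventually.of_forall fun φ => ?_)
  dsimp only
  have hg' : g (fun x => φ x - 2 * Real.pi * (n.1 x : ℝ)) = g φ := by
    have h := hper (fun x => φ x - 2 * Real.pi * (n.1 x : ℝ)) n.1
    simp only [sub_add_cancel] at h
    exact h.symm
  simp only [d₀_sub_arg, hg']

end UnfoldedLift

/-- **stub U3 (M/L): the unfolded lift identity on a charted torus** (registered signature, verbatim).  For a
continuous `2πℤ^Λ`-periodic `g`, the cube integral `∫_{[0,2π)^Λ} g` is the `HasSum`, over the integer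
`1`-cochains `a` in TREE GAUGE (vanishing on the axial comb tree), of the integrals over the PINNED field space
`{φ : φ 0 ∈ [0,2π)}` of `g` times the smoothed-box bond weight `Π_{x,i} χ_v(d₀φ(x,i) − 2π a(x,i))`
(`hasSum_treeGauge_pinned` with the smoothed box `χ_v(s) = ∫_{[-π,π]} g_v(s − t) dt`: `smoothedBox_hasSum`,
`continuous_smoothedBox`). [folklore] -/
theorem stub_unfoldedLiftIdentity :
    ∀ (Λ : Type) [AddCommGroup Λ] [Fintype Λ] [DecidableEq Λ] (d : ℕ) (F : TorusChart Λ d) (v : NNReal), v ≠ 0 →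
      ∀ g : (Λ → ℝ) → ℂ, Continuous g →
        (∀ (φ : Λ → ℝ) (n : Λ → ℤ), g (fun x => φ x + 2 * Real.pi * (n x : ℝ)) = g φ) →
        HasSum (fun a : {a : Λ → Fin d → ℤ // ∀ (y : Λ) (μ : Fin d), (∀ ν : Fin d, μ < ν → F.cval ν y = 0) →
              F.cval μ y + 1 < F.period μ → a y μ = 0} =>
            ∫ φ in {φ : Λ → ℝ | φ 0 ∈ Set.Ico 0 (2 * Real.pi)},
              g φ * ∏ x : Λ, ∏ i : Fin d, ((∫ t in Set.Icc (-Real.pi) Real.pi,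
                ProbabilityTheory.gaussianPDFReal 0 v (F.d₀ φ x i - 2 * Real.pi * (a.1 x i : ℝ) - t) : ℝ) : ℂ))
          (∫ φ in Set.pi Set.univ (fun _ : Λ => Set.Ico (0:ℝ) (2 * Real.pi)), g φ) := by
  intro Λ _ _ _ d F v hv g hg hper
  have hwc : Continuous fun s : ℝ => ∫ t in Set.Icc (-Real.pi) Real.pi,
      ProbabilityTheory.gaussianPDFReal 0 v (s - t) := by
    have h := continuous_smoothedBox v 0
    simp only [Int.cast_zero, mul_zero, sub_zero] at h
    exact h
  exact hasSum_treeGauge_pinned F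
    (fun s => ∫ t in Set.Icc (-Real.pi) Real.pi, ProbabilityTheory.gaussianPDFReal 0 v (s - t))
    (fun s => integral_nonneg fun _ => ProbabilityTheory.gaussianPDFReal_nonneg 0 v _)
    (fun s => smoothedBox_hasSum v hv s) hwc g hg hper

end Summit.HubbardSuperconductivity.HubbardSuperconductivity.Theorems.FSUnfolding
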